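import Literature.Computability.Complexity.BCSP
import Literature.Computability.Complexity.CNF
import HarnessLib

/-!
# A `q`-CNF as a Boolean constraint system of arity `q` (Arora–Barak, §11.3.1: "3CNF formulas are a special case of 3CSP instances")

The entry point of Dinur's iteration (Arora–Barak 2009, §22.2.1: "`qCSP` is a generalization of
`3SAT`, and is **NP**-hard … `val(φ)` is either `1` (if `φ` is satisfiable) or `1 - 1/m` if it is
not"; §11.3.1: "3CNF formulas are a special case of 3CSP"): a CNF `φ` over `ℕ` all of whose clauses
have at most `q` literals, as an instance `BCSP.ofCNF q φ : BCSP q` (`BCSP.lean`) with one constraint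
per clause — variables `Fin (numVars φ + 1)` (the last one a dummy filling the unused positions),
constraint `c` reading the variables of its literals and accepting iff one of them has the required
polarity.

* `acc_ofCNF_iff` — the constraint of a clause accepts iff the clause is true under the restricted
  assignment `restr σ'`;
* `ofCNF_sat` — a satisfiable `q`-CNF gives a satisfiable instance;
* `ofCNF_gap` — an unsatisfiable `q`-CNF gives an instance in which every assignment violates at least
  one of the `m` constraints: `Gap (1/m)` ("`val(φ) ≤ 1 - 1/m`").

## References

* S. Arora, B. Barak, *Computational Complexity: A Modern Approach*, CUP 2009, §11.3.1, §22.2.1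
  (first paragraph of the proof of Thm. 11.5 from Lemma 22.4).
-/

namespace Literature.Computability.Complexity

open Finset

namespace Expander

namespace BCSP

variable (q : ℕ)

/-- The constraint of a clause: position `i < |c|` reads the variable of the `i`-th literal (clipped
below `numVars φ`, which changes nothing for clauses of `φ`), the other positions read the dummy
variable; it accepts iff some literal position carries the literal's polarity.
[cite: AroraBarakCC2009, §11.3.1 ("3CNF formulas are a special case of 3CSP instances")] -/
def clauseCons (φ : CNF ℕ) (c : Clause ℕ) : (Fin q → Fin (φ.numVars + 1)) × ((Fin q → Bool) → Bool) :=
  (fun i => if h : i.val < c.length then ⟨min (c[i.val]).1 φ.numVars, by omega⟩ else ⟨φ.numVars, Nat.lt_succ_self _⟩,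
    fun τ => decide (∃ i : Fin q, ∃ h : i.val < c.length, τ i = (c[i.val]).2))

/-- **The `q`-CNF `φ` as a `BCSP q` instance**: one constraint per clause. [cite: AroraBarakCC2009, §11.3.1 and §22.2.1] -/
def ofCNF (φ : CNF ℕ) : BCSP q := ⟨φ.numVars + 1, φ.map (clauseCons q φ)⟩

/-- `ofCNF` has one constraint per clause. [folklore] -/
@[simp] theorem ofCNF_length (φ : CNF ℕ) : (ofCNF q φ).cons.length = φ.length := by simp [ofCNF]

/-- `ofCNF` has `numVars φ + 1` variables. [folklore] -/
@[simp] theorem ofCNF_nV (φ : CNF ℕ) : (ofCNF q φ).nV = φ.numVars + 1 := rfl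

/-- The assignment of the CNF variables read off from an assignment of the instance (variables beyond
`numVars` clipped to the dummy). [folklore] -/
def restr (φ : CNF ℕ) (σ' : Fin (ofCNF q φ).nV → Bool) (x : ℕ) : Bool :=
  σ' ⟨min x φ.numVars, show min x φ.numVars < φ.numVars + 1 by omega⟩

/-- **The constraint of a clause accepts iff the clause is true** (clauses of width `≤ q`). [cite: AroraBarakCC2009, §11.3.1] -/
theorem clauseCons_acc_iff (φ : CNF ℕ) {c : Clause ℕ} (hc : c.length ≤ q) (σ' : Fin (ofCNF q φ).nV → Bool) :
    (clauseCons q φ c).2 (σ' ∘ (clauseCons q φ c).1) = true ↔ Clause.eval (restr q φ σ') c = true := by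
  unfold clauseCons
  simp only [decide_eq_true_eq, Function.comp_apply]
  rw [Clause.eval, List.any_eq_true]
  constructor
  · rintro ⟨i, hi, h⟩
    refine ⟨c[i.val], List.getElem_mem hi, ?_⟩
    rw [Literal.eval, beq_iff_eq, restr, ← h, dif_pos hi]
    rfl
  · rintro ⟨l, hl, hev⟩
    obtain ⟨i, hi, rfl⟩ := List.getElem_of_mem hl
    refine ⟨⟨i, lt_of_lt_of_le hi hc⟩, hi, ?_⟩
    rw [Literal.eval, beq_iff_eq, restr] at hev
    rw [← hev, dif_pos hi]
    rfl

/-- Constraint indices of `ofCNF` are clause indices. [folklore] -/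
theorem lt_length_of_fin {φ : CNF ℕ} (s : Fin (ofCNF q φ).cons.length) : s.val < φ.length :=
  lt_of_lt_of_eq s.2 (ofCNF_length q φ)

/-- The constraints of `ofCNF`. [folklore] -/
theorem ofCNF_cons_getElem (φ : CNF ℕ) (s : Fin (ofCNF q φ).cons.length) :
    (ofCNF q φ).cons[s] = clauseCons q φ (φ[s.val]'(lt_length_of_fin q s)) := by
  show (φ.map (clauseCons q φ))[s.val] = _
  rw [List.getElem_map]

/-- **The constraint of clause `s` accepts iff the clause is true under the restricted assignment.** [cite: AroraBarakCC2009, §11.3.1] -/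
theorem acc_ofCNF_iff {φ : CNF ℕ} (s : Fin (ofCNF q φ).cons.length) (hc : (φ[s.val]'(lt_length_of_fin q s)).length ≤ q)
    (σ' : Fin (ofCNF q φ).nV → Bool) :
    (ofCNF q φ).acc s (σ' ∘ (ofCNF q φ).vars s) = true ↔ Clause.eval (restr q φ σ') (φ[s.val]'(lt_length_of_fin q s)) = true := by
  unfold BCSP.acc BCSP.vars
  rw [ofCNF_cons_getElem]
  exact clauseCons_acc_iff q φ hc σ'

/-- **A satisfiable `q`-CNF gives a satisfiable instance.** [cite: AroraBarakCC2009, §22.2.1 ("val(φ) is … 1 (if φ is satisfiable)")] -/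
theorem ofCNF_sat {φ : CNF ℕ} (hw : φ.IsWidthLE q) (h : φ.Satisfiable) : (ofCNF q φ).Sat := by
  obtain ⟨σ, hσ⟩ := h
  refine ⟨fun v => σ v.val, fun s => ?_⟩
  have hmem : φ[s.val]'(lt_length_of_fin q s) ∈ φ := List.getElem_mem _
  rw [acc_ofCNF_iff q s (hw _ hmem)]
  rw [CNF.eval, List.all_eq_true] at hσ
  have hc := hσ _ hmem
  -- the restricted assignment agrees with `σ` on the variables of the clause
  rw [List.any_eq_true] at hc
  rw [Clause.eval, List.any_eq_true]
  obtain ⟨l, hl, hev⟩ := hc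
  refine ⟨l, hl, ?_⟩
  rw [Literal.eval] at hev ⊢
  rw [restr]
  simp only
  rw [min_eq_left (CNF.lt_numVars_of_mem_of_mem hmem hl).le]
  exact hev

/-- **An unsatisfiable `q`-CNF gives an instance in which every assignment violates at least one of the
`m` constraints**: `Gap (1/m)`. [cite: AroraBarakCC2009, §22.2.1 ("val(φ) … is 1 - 1/m if it is not [satisfiable]")] -/
theorem ofCNF_gap {φ : CNF ℕ} (hw : φ.IsWidthLE q) (h : ¬ φ.Satisfiable) : (ofCNF q φ).Gap (1 / φ.length) := by
  classical
  intro σ'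
  -- the restricted assignment falsifies some clause
  have hfalse : ∃ c ∈ φ, Clause.eval (restr q φ σ') c = false := by
    by_contra hall
    push Not at hall
    refine h ⟨restr q φ σ', ?_⟩
    rw [CNF.eval, List.all_eq_true]
    intro c hc
    have hne := hall c hc
    change Clause.eval (restr q φ σ') c = true
    cases hev : Clause.eval (restr q φ σ') c
    · exact absurd hev hne
    · rfl
  obtain ⟨c, hc, hcf⟩ := hfalse
  obtain ⟨i, hi, rfl⟩ := List.getElem_of_mem hc
  have hlen : i < (ofCNF q φ).cons.length := by rw [ofCNF_length]; exact hi
  have hviol : 1 ≤ (ofCNF q φ).viol σ' := by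
    unfold BCSP.viol
    refine card_pos.2 ⟨⟨i, hlen⟩, mem_filter.2 ⟨mem_univ _, ?_⟩⟩
    rw [Bool.eq_false_iff]
    intro hacc
    rw [acc_ofCNF_iff q ⟨i, hlen⟩ (hw _ hc)] at hacc
    simp only at hacc
    rw [hacc] at hcf
    exact Bool.noConfusion hcf
  rw [ofCNF_length]
  have hm : 0 < φ.length := List.length_pos_of_mem hc
  have hmR : (0 : ℝ) < φ.length := by exact_mod_cast hm
  rw [one_div, inv_mul_cancel₀ hmR.ne']
  exact_mod_cast hviol

end BCSP

end Expander

end Literature.Computability.Complexity
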